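import Literature.Geometry.Riemannian.RicciFlowScalarMaximumPrinciple
import Literature.Geometry.Riemannian.RicciFlowScalarCurvatureRegularity
import Literature.Geometry.Riemannian.CurvatureNormSq
import Literature.Geometry.Lorentzian.EnergyCurrents
import Summits.SmoothPoincare4.SmoothPoincare4.Theorems.EntropyRungChangGurskyYangStubRoundnessRateAux
import Mathlib.Analysis.SpecialFunctions.Pow.Real
import Mathlib.Geometry.Manifold.Algebra.LieGroup
import HarnessLib

/-!
# Hamilton's gradient estimate `|∇R|² ≤ ηR³ + C(η)` — the maximum-principle endgame
(helper `helper_gradientBound_of_evolution` of stub `stub_gradientEstimates` of line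
`margerin-cone-hamilton-rails`, crux `EntropyRung.ChangGurskyYang`, item stmt-SmoothPoincare4-10834)

Hamilton 1982, §11, Thm. 11.1 in unnormalised four-dimensional clothes. Along a Ricci flow `(g, cov)`
on `[0, T)` on a closed 4-manifold with the invariant pinching `m ≤ R`, `|W|² + 2|E|² ≤ K R^{2−τ}`
(`0 < τ ≤ 1`), write `R` for the scalar curvature, `V = |∇R|²`, `N = |Ric|²`, `Q = |Rm|²`,
`|E|² = N − R²/4`, `|W|² = Q − 2N + R²/3`. GIVEN (as hypotheses, produced by the sibling helpers)
the joint smoothness of `V` and `N` on `M × [0, T']` for every `0 < T' < T` and Hamilton's evolution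
inequality for `u = V/R + 180(1+Λ)|E|² − ηR²`,

  `∂ₜu ≤ Δu + Φ`, `Φ = (2η − 1)V + 180(1+Λ)(64√Q + R)|E|² − 4ηR·N`,

valid for every `Λ ≥ 0`, `η ∈ ℝ`, `0 < T' < T` at every point with `|E|² ≤ ΛR²`, we PROVE: for
every `η > 0` there is `C` with `V ≤ ηR³ + C` on `M × [0, T)`.

## Proof (fact-free)

* `gradientBound_source_le`: with `η₀ ≤ 1/2`, `Λ ≥ 0`, the source term is bounded by a constant,
  `Φ ≤ C₂(m, K, τ, Λ, η₀)`: `(2η₀ − 1)V ≤ 0`, `4η₀RN ≥ η₀R³` (`N ≥ R²/4`),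
  `Q ≤ K R^{2−τ} + R²/6 ≤ (Km^{−τ} + 1/6)R²` so `√Q ≤ cR`, `|E|² ≤ (K/2)R^{2−τ}`; hence
  `Φ ≤ C₁R^{3−τ} − η₀R³ ≤ C₁R₀^{3−τ}` with `R₀ = (C₁/η₀)^{1/τ}`.
* `gradientBound_traceless_le`: `|E|² ≤ (K/2)R^{2−τ} ≤ (Km^{−τ}/2)R²`, so `Λ = Km^{−τ}/2` works.
* `gradientBound_maxPrinciple`: Topping's weak maximum principle (`weakMaximumPrinciple`, Thm. 3.1.1)
  on `[0, T']` with `X = 0`, `F ≡ C₂`, `φ(s) = α + sC₂`, `α = max u(0, ·)`; the joint regularity of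
  `u` is assembled from that of `R` (`IsRicciFlow.contMDiffOn_scalarCurvatureWith`), `V`, `N`
  (`gradientBound_smooth`).
* `gradientBound_final`: `u ≤ B` gives `V ≤ R(B + η₀R²) ≤ 2η₀R³ + C`; with `2η₀ ≤ η` this is the
  claim (`gradientBound_core`, in the abstract functions `R, V, N, Q`; the registered statement
  `helper_gradientBound_of_evolution` specialises them to the flow quantities, reading the pinching
  through `roundness_dictionary`).

## References

* R. S. Hamilton, *Three-manifolds with positive Ricci curvature*, J. Differential Geom. 17
  (1982) 255–306, §11, Thm. 11.1. [Hamilton1982]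
* P. Topping, *Lectures on the Ricci flow*, LMS Lecture Note Series 325, CUP 2006, Thm. 3.1.1.
  [Topping2006]
-/

noncomputable section

-- every `Summit.SmoothPoincare4.SmoothPoincare4.…` name repeats the summit = sub-problem segment (D-0017 layout)
set_option linter.dupNamespace false

open Set Function Filter
open scoped Manifold ContDiff Topology

namespace Summit.SmoothPoincare4.SmoothPoincare4.Theorems.MargerinRails

open Literature.Geometry.Riemannian
open Literature.Geometry.Lorentzian Literature.Geometry.Lorentzian.PseudoRiemannianMetric

/-! ### Real-variable estimates -/

/-- `K R^{2−τ} ≤ K m^{−τ} R²` for `R ≥ m > 0`, `K, τ ≥ 0` (`R^{−τ} ≤ m^{−τ}`).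
[cite: Hamilton1982, §11, Thm. 11.1] -/
theorem gradientBound_rpow_le {m K τ R : ℝ} (hm : 0 < m) (hK : 0 ≤ K) (hτ0 : 0 ≤ τ) (hmR : m ≤ R) :
    K * R ^ (2 - τ) ≤ K * m ^ (-τ) * R ^ 2 := by
  have hR0 : 0 < R := hm.trans_le hmR
  have hrpow : R ^ (2 - τ) ≤ m ^ (-τ) * R ^ 2 := by
    rw [sub_eq_add_neg, Real.rpow_add hR0, Real.rpow_two, mul_comm]
    exact mul_le_mul_of_nonneg_right (Real.rpow_le_rpow_of_nonpos hm hmR (by linarith))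
      (sq_nonneg _)
  calc K * R ^ (2 - τ) ≤ K * (m ^ (-τ) * R ^ 2) := mul_le_mul_of_nonneg_left hrpow hK
    _ = K * m ^ (-τ) * R ^ 2 := by ring

/-- **The traceless Ricci part is quadratically small**: under the pinching
`|W|² + 2|E|² ≤ K R^{2−τ}`, `|W|² ≥ 0`, `R ≥ m > 0`, one has `|E|² ≤ (K m^{−τ}/2) R²`.
[cite: Hamilton1982, §11, Thm. 11.1] -/
theorem gradientBound_traceless_le {m K τ R N W : ℝ} (hm : 0 < m) (hK : 0 ≤ K) (hτ0 : 0 ≤ τ)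
    (hmR : m ≤ R) (hW : 0 ≤ W) (hp : W + 2 * (N - R ^ 2 / 4) ≤ K * R ^ (2 - τ)) :
    N - R ^ 2 / 4 ≤ K * m ^ (-τ) / 2 * R ^ 2 := by
  have := gradientBound_rpow_le hm hK hτ0 hmR
  linarith

/-- **The source term of Hamilton's function is bounded above** (Hamilton 1982, proof of
Thm. 11.1): for `0 < η₀ ≤ 1/2`, `Λ ≥ 0` there is `C₂ ≥ 0` with
`(2η₀ − 1)V + 180(1+Λ)(64√Q + R)|E|² − 4η₀RN ≤ C₂` whenever `R ≥ m`, `V ≥ 0`, `|E|² ≥ 0`,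
`|W|² ≥ 0`, `|W|² + 2|E|² ≤ K R^{2−τ}` (`|E|² = N − R²/4`, `|W|² = Q − 2N + R²/3`): the positive
part is `≤ C₁R^{3−τ}`, the Ricci term is `≤ −η₀R³`, and `C₁R^{3−τ} − η₀R³ ≤ C₁R₀^{3−τ}`,
`R₀ = (C₁/η₀)^{1/τ}`. [cite: Hamilton1982, §11, Thm. 11.1] -/
theorem gradientBound_source_le {m K τ Λ η₀ : ℝ} (hm : 0 < m) (hK : 0 < K) (hτ0 : 0 < τ)
    (hτ1 : τ ≤ 1) (hΛ : 0 ≤ Λ) (hη₀ : 0 < η₀) (hη₀1 : η₀ ≤ 1 / 2) :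
    ∃ C₂ : ℝ, 0 ≤ C₂ ∧ ∀ R V N Q : ℝ, m ≤ R → 0 ≤ V → 0 ≤ N - R ^ 2 / 4 →
      0 ≤ Q - 2 * N + R ^ 2 / 3 →
      (Q - 2 * N + R ^ 2 / 3) + 2 * (N - R ^ 2 / 4) ≤ K * R ^ (2 - τ) →
      (2 * η₀ - 1) * V + 180 * (1 + Λ) * (64 * Real.sqrt Q + R) * (N - R ^ 2 / 4)
        - 4 * η₀ * (R * N) ≤ C₂ := by
  set A : ℝ := K * m ^ (-τ) + 1 / 6 with hA
  have hA0 : 0 < A := by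
    rw [hA]; exact add_pos_of_nonneg_of_pos (mul_nonneg hK.le (Real.rpow_nonneg hm.le _)) (by norm_num)
  set C₁ : ℝ := 90 * K * (1 + Λ) * (64 * Real.sqrt A + 1) with hC₁
  have hC₁0 : 0 ≤ C₁ := by
    rw [hC₁]
    exact mul_nonneg (mul_nonneg (mul_nonneg (by norm_num) hK.le) (by linarith))
      (add_nonneg (mul_nonneg (by norm_num) (Real.sqrt_nonneg _)) zero_le_one)
  have hC₁η : 0 ≤ C₁ / η₀ := div_nonneg hC₁0 hη₀.le
  set R₀ : ℝ := (C₁ / η₀) ^ (1 / τ) with hR₀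
  have hR₀0 : 0 ≤ R₀ := Real.rpow_nonneg hC₁η _
  refine ⟨C₁ * R₀ ^ (3 - τ), mul_nonneg hC₁0 (Real.rpow_nonneg hR₀0 _), ?_⟩
  intro R V N Q hmR hV hE hW hp
  have hR0 : 0 < R := hm.trans_le hmR
  have hKR := gradientBound_rpow_le hm hK.le hτ0.le hmR
  -- `Q ≤ A R²` and `√Q ≤ √A R`
  have hQ : Q ≤ A * R ^ 2 := by
    rw [hA]; linarith
  have hsqrt : Real.sqrt Q ≤ Real.sqrt A * R := by
    rw [Real.sqrt_le_left (mul_nonneg (Real.sqrt_nonneg _) hR0.le), mul_pow, Real.sq_sqrt hA0.le]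
    exact hQ
  -- the positive source term is `≤ C₁ R^{3-τ}`
  have hE' : N - R ^ 2 / 4 ≤ K / 2 * R ^ (2 - τ) := by linarith
  have hmain : 180 * (1 + Λ) * (64 * Real.sqrt Q + R) * (N - R ^ 2 / 4) ≤ C₁ * R ^ (3 - τ) := by
    have h1 : 64 * Real.sqrt Q + R ≤ (64 * Real.sqrt A + 1) * R := by linarith
    have h2 : 180 * (1 + Λ) * (64 * Real.sqrt Q + R) ≤ 180 * (1 + Λ) * ((64 * Real.sqrt A + 1) * R) :=
      mul_le_mul_of_nonneg_left h1 (by linarith)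
    have h3 : R * R ^ (2 - τ) = R ^ (3 - τ) := by
      rw [show (3 : ℝ) - τ = 1 + (2 - τ) by ring, Real.rpow_add hR0, Real.rpow_one]
    have h4 : 0 ≤ 180 * (1 + Λ) * ((64 * Real.sqrt A + 1) * R) :=
      mul_nonneg (by linarith) (mul_nonneg (by linarith [Real.sqrt_nonneg A]) hR0.le)
    calc 180 * (1 + Λ) * (64 * Real.sqrt Q + R) * (N - R ^ 2 / 4)
        ≤ 180 * (1 + Λ) * ((64 * Real.sqrt A + 1) * R) * (K / 2 * R ^ (2 - τ)) :=
          mul_le_mul h2 hE' hE h4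
      _ = C₁ * (R * R ^ (2 - τ)) := by rw [hC₁]; ring
      _ = C₁ * R ^ (3 - τ) := by rw [h3]
  -- the Ricci term: `4η₀ R N ≥ η₀ R³`
  have hRic : η₀ * R ^ 3 ≤ 4 * η₀ * (R * N) := by
    have h1 : R ^ 2 / 4 * R ≤ N * R := mul_le_mul_of_nonneg_right (by linarith) hR0.le
    have h2 := mul_le_mul_of_nonneg_left h1 hη₀.le
    linarith
  -- the gradient term: `(2η₀ - 1) V ≤ 0`
  have hVterm : (2 * η₀ - 1) * V ≤ 0 := by nlinarith
  have hΦ : (2 * η₀ - 1) * V + 180 * (1 + Λ) * (64 * Real.sqrt Q + R) * (N - R ^ 2 / 4)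
      - 4 * η₀ * (R * N) ≤ C₁ * R ^ (3 - τ) - η₀ * R ^ 3 := by linarith
  -- `C₁ R^{3-τ} - η₀ R³ ≤ C₁ R₀^{3-τ}`
  rcases le_or_gt R₀ R with hle | hlt
  · -- `R ≥ R₀`: `C₁ ≤ η₀ R^τ`, so the difference is `≤ 0`
    have hτR : C₁ ≤ η₀ * R ^ τ := by
      have h1 : R₀ ^ τ ≤ R ^ τ := Real.rpow_le_rpow hR₀0 hle hτ0.le
      have h2 : R₀ ^ τ = C₁ / η₀ := by
        rw [hR₀, ← Real.rpow_mul hC₁η, one_div_mul_cancel hτ0.ne', Real.rpow_one]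
      rw [h2, div_le_iff₀ hη₀] at h1
      linarith
    have h3 : R ^ τ * R ^ (3 - τ) = R ^ 3 := by
      rw [← Real.rpow_add hR0, show τ + (3 - τ) = ((3 : ℕ) : ℝ) by push_cast; ring,
        Real.rpow_natCast]
    have h4 : C₁ * R ^ (3 - τ) ≤ η₀ * R ^ 3 :=
      calc C₁ * R ^ (3 - τ) ≤ η₀ * R ^ τ * R ^ (3 - τ) :=
            mul_le_mul_of_nonneg_right hτR (Real.rpow_nonneg hR0.le _)
        _ = η₀ * R ^ 3 := by rw [mul_assoc, h3]
    have h5 : 0 ≤ C₁ * R₀ ^ (3 - τ) := mul_nonneg hC₁0 (Real.rpow_nonneg hR₀0 _)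
    linarith
  · -- `R < R₀`
    have h1 : R ^ (3 - τ) ≤ R₀ ^ (3 - τ) := Real.rpow_le_rpow hR0.le hlt.le (by linarith)
    have h2 : C₁ * R ^ (3 - τ) ≤ C₁ * R₀ ^ (3 - τ) := mul_le_mul_of_nonneg_left h1 hC₁0
    have h3 : 0 ≤ η₀ * R ^ 3 := mul_nonneg hη₀.le (pow_nonneg hR0.le 3)
    linarith

/-- **From the bound on Hamilton's function to the gradient estimate**: if
`V/R + L|E|² − η₀R² ≤ B` with `R > 0`, `L|E|² ≥ 0`, then `V ≤ 2η₀R³ + C(B, η₀)`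
(`BR ≤ η₀R³ + B⁺R₁`, `R₁ = √(B⁺/η₀)`). [cite: Hamilton1982, §11, Thm. 11.1] -/
theorem gradientBound_final {η₀ : ℝ} (hη₀ : 0 < η₀) (B : ℝ) :
    ∃ C : ℝ, ∀ R V E L : ℝ, 0 < R → 0 ≤ E → 0 ≤ L → V / R + L * E - η₀ * R ^ 2 ≤ B →
      V ≤ 2 * η₀ * R ^ 3 + C := by
  set B' : ℝ := max B 0 with hB'
  have hB'0 : 0 ≤ B' := le_max_right _ _
  have hBB' : B ≤ B' := le_max_left _ _
  set R₁ : ℝ := Real.sqrt (B' / η₀) with hR₁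
  have hR₁0 : 0 ≤ R₁ := Real.sqrt_nonneg _
  have hR₁sq : η₀ * R₁ ^ 2 = B' := by
    rw [hR₁, Real.sq_sqrt (div_nonneg hB'0 hη₀.le)]
    field_simp
  refine ⟨B' * R₁, fun R V E L hR hE hL hu ↦ ?_⟩
  have hLE : 0 ≤ L * E := mul_nonneg hL hE
  have h1 : V / R ≤ B' + η₀ * R ^ 2 := by linarith
  have h2 : V ≤ (B' + η₀ * R ^ 2) * R := (div_le_iff₀ hR).1 h1
  have key : R₁ ^ 2 * R ≤ R ^ 3 + R₁ ^ 3 := by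
    nlinarith [mul_nonneg (sq_nonneg (R - R₁)) (add_nonneg hR.le hR₁0),
      mul_nonneg (sq_nonneg R) hR₁0]
  have h3 : B' * R ≤ η₀ * R ^ 3 + B' * R₁ := by
    have := mul_le_mul_of_nonneg_left key hη₀.le
    rw [← hR₁sq]
    linarith
  linarith

/-! ### The maximum-principle step, in the abstract functions `R, V, N, Q` -/

section FourDim

variable {M : Type*} [TopologicalSpace M] [ChartedSpace (EuclideanSpace ℝ (Fin 4)) M]
  [IsManifold (𝓡 4) ∞ M] [CompactSpace M]
  {g : ℝ → PseudoRiemannianMetric (𝓡 4) ∞ (EuclideanSpace ℝ (Fin 4)) (TangentSpace (𝓡 4) : M → Type _)}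
  {T m K τ : ℝ}

omit [CompactSpace M] in
/-- `g(v, v) ≥ 0` for a Riemannian metric. [folklore] -/
theorem gradientBound_val_self_nonneg
    {g₀ : PseudoRiemannianMetric (𝓡 4) ∞ (EuclideanSpace ℝ (Fin 4)) (TangentSpace (𝓡 4) : M → Type _)}
    (hg : g₀.IsRiemannian) (x : M) (v : TangentSpace (𝓡 4) x) : 0 ≤ g₀.val x v v := by
  by_cases hv : v = 0
  · rw [hv]; simp
  · exact (hg x v hv).le

omit [CompactSpace M] in
/-- `|∇ψ|²_g = g(♯dψ, ♯dψ) ≥ 0` for a Riemannian metric. [folklore] -/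
theorem gradientBound_gradSq_nonneg
    {g₀ : PseudoRiemannianMetric (𝓡 4) ∞ (EuclideanSpace ℝ (Fin 4)) (TangentSpace (𝓡 4) : M → Type _)}
    (hg : g₀.IsRiemannian) (ψ : M → ℝ) (x : M) : 0 ≤ g₀.gradSq ψ x := by
  rw [PseudoRiemannianMetric.gradSq, innerDual_eq_val_sharp_sharp]
  exact gradientBound_val_self_nonneg hg x _

omit [IsManifold (𝓡 4) ∞ M] [CompactSpace M] in
/-- **Joint regularity of Hamilton's function** `u = V/R + 180(1+Λ)(N − R²/4) − η₀R²` on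
`M × [0, T']` from that of `R > 0`, `V`, `N` (smooth algebra of `C^∞` maps into `ℝ`). [folklore] -/
theorem gradientBound_smooth {T' Λ η₀ : ℝ} {R V N : ℝ → M → ℝ}
    (hRs : ContMDiffOn ((𝓡 4).prod 𝓘(ℝ, ℝ)) 𝓘(ℝ, ℝ) ∞ (fun p : M × ℝ ↦ R p.2 p.1) (univ ×ˢ Icc 0 T'))
    (hVs : ContMDiffOn ((𝓡 4).prod 𝓘(ℝ, ℝ)) 𝓘(ℝ, ℝ) ∞ (fun p : M × ℝ ↦ V p.2 p.1) (univ ×ˢ Icc 0 T'))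
    (hNs : ContMDiffOn ((𝓡 4).prod 𝓘(ℝ, ℝ)) 𝓘(ℝ, ℝ) ∞ (fun p : M × ℝ ↦ N p.2 p.1) (univ ×ˢ Icc 0 T'))
    (hR0 : ∀ s ∈ Icc 0 T', ∀ x : M, 0 < R s x) :
    ContMDiffOn ((𝓡 4).prod 𝓘(ℝ, ℝ)) 𝓘(ℝ, ℝ) ∞
      (fun p : M × ℝ ↦ V p.2 p.1 / R p.2 p.1 + 180 * (1 + Λ) * (N p.2 p.1 - R p.2 p.1 ^ 2 / 4)
        - η₀ * R p.2 p.1 ^ 2) (univ ×ˢ Icc 0 T') := by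
  have hne : ∀ p ∈ univ ×ˢ Icc (0 : ℝ) T', (fun p : M × ℝ ↦ R p.2 p.1) p ≠ 0 := fun p hp ↦
    (hR0 p.2 hp.2 p.1).ne'
  exact ((hVs.div₀ hRs hne).add (contMDiffOn_const.mul (hNs.sub ((hRs.pow 2).div_const 4)))).sub
    (contMDiffOn_const.mul (hRs.pow 2))

/-- **The maximum-principle step** (Topping 2006, Thm. 3.1.1 with `X = 0`, `F ≡ C₂`,
`φ(s) = α + sC₂`): if `u = V/R + 180(1+Λ)(N − R²/4) − η₀R²` is jointly smooth on `M × [0, T']`,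
satisfies `∂ₜu ≤ Δu + Φ` with `Φ ≤ C₂`, and `u(0, ·) ≤ α`, then `u(s, ·) ≤ α + sC₂` on `[0, T']`.
[cite: Topping2006, Thm. 3.1.1 (p. 35)] -/
theorem gradientBound_maxPrinciple {T' Λ η₀ C₂ α : ℝ} (hT' : 0 < T')
    (hgR : ∀ s ∈ Icc 0 T', (g s).IsRiemannian) {R V N Q : ℝ → M → ℝ}
    (hRs : ContMDiffOn ((𝓡 4).prod 𝓘(ℝ, ℝ)) 𝓘(ℝ, ℝ) ∞ (fun p : M × ℝ ↦ R p.2 p.1) (univ ×ˢ Icc 0 T'))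
    (hVs : ContMDiffOn ((𝓡 4).prod 𝓘(ℝ, ℝ)) 𝓘(ℝ, ℝ) ∞ (fun p : M × ℝ ↦ V p.2 p.1) (univ ×ˢ Icc 0 T'))
    (hNs : ContMDiffOn ((𝓡 4).prod 𝓘(ℝ, ℝ)) 𝓘(ℝ, ℝ) ∞ (fun p : M × ℝ ↦ N p.2 p.1) (univ ×ˢ Icc 0 T'))
    (hR0 : ∀ s ∈ Icc 0 T', ∀ x : M, 0 < R s x)
    (hevol : ∀ s ∈ Icc 0 T', ∀ x : M,
      derivWithin (fun r ↦ V r x / R r x + 180 * (1 + Λ) * (N r x - R r x ^ 2 / 4)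
          - η₀ * R r x ^ 2) (Icc 0 T') s ≤
        (g s).laplaceBeltrami (fun y ↦ V s y / R s y + 180 * (1 + Λ) * (N s y - R s y ^ 2 / 4)
          - η₀ * R s y ^ 2) x +
          ((2 * η₀ - 1) * V s x + 180 * (1 + Λ) * (64 * Real.sqrt (Q s x) + R s x) *
            (N s x - R s x ^ 2 / 4) - 4 * η₀ * (R s x * N s x)))
    (hΦ : ∀ s ∈ Icc 0 T', ∀ x : M,
      (2 * η₀ - 1) * V s x + 180 * (1 + Λ) * (64 * Real.sqrt (Q s x) + R s x) *
        (N s x - R s x ^ 2 / 4) - 4 * η₀ * (R s x * N s x) ≤ C₂)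
    (hu0 : ∀ x : M, V 0 x / R 0 x + 180 * (1 + Λ) * (N 0 x - R 0 x ^ 2 / 4) - η₀ * R 0 x ^ 2 ≤ α) :
    ∀ s ∈ Icc 0 T', ∀ x : M,
      V s x / R s x + 180 * (1 + Λ) * (N s x - R s x ^ 2 / 4) - η₀ * R s x ^ 2 ≤ α + s * C₂ := by
  have hF : ContDiffOn ℝ 1 (uncurry fun (_ : ℝ) (_ : ℝ) ↦ C₂) (univ ×ˢ Icc 0 T') :=
    contDiffOn_const (c := C₂)
  have hφ : ∀ s ∈ Icc 0 T', HasDerivWithinAt (fun r : ℝ ↦ α + r * C₂)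
      ((fun (_ : ℝ) (_ : ℝ) ↦ C₂) ((fun r : ℝ ↦ α + r * C₂) s) s) (Icc 0 T') s := fun s _ ↦
    ((hasDerivAt_mul_const C₂).const_add α).hasDerivWithinAt
  refine weakMaximumPrinciple hT' hgR (fun (_ : ℝ) (y : M) ↦ (0 : TangentSpace (𝓡 4) y)) hF
    (u := fun s x ↦ V s x / R s x + 180 * (1 + Λ) * (N s x - R s x ^ 2 / 4) - η₀ * R s x ^ 2)
    (gradientBound_smooth (Λ := Λ) (η₀ := η₀) hRs hVs hNs hR0) (fun s hs x ↦ ?_) hφ (by simp) hu0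
  have h1 := hevol s hs x
  have h2 := hΦ s hs x
  simp only [map_zero, add_zero]
  linarith

/-- **Hamilton 1982, Thm. 11.1, abstract form.** For functions `R, V, N, Q` on `[0, T) × M` with
the pinching dictionary (`m ≤ R`, `0 ≤ N − R²/4`, `0 ≤ Q − 2N + R²/3`,
`(Q − 2N + R²/3) + 2(N − R²/4) ≤ K R^{2−τ}`), `V ≥ 0`, joint smoothness of `R, V, N` on every
`M × [0, T']`, and the evolution inequality `∂ₜu ≤ Δ_{g(t)}u + Φ` for
`u = V/R + 180(1+Λ)(N − R²/4) − ηR²` (all `Λ ≥ 0`, `η`, wherever `N − R²/4 ≤ ΛR²`): for every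
`η > 0` there is `C` with `V ≤ ηR³ + C` on `[0, T)`. Proof: `η₀ = min(η,1)/2`, `Λ = Km^{−τ}/2`,
`Φ ≤ C₂` (`gradientBound_source_le`), the weak maximum principle on each `[0, t]`
(`gradientBound_maxPrinciple`) gives `u ≤ α + TC₂`, and `gradientBound_final`.
[cite: Hamilton1982, §11, Thm. 11.1] -/
theorem gradientBound_core (hT : 0 < T) (hm : 0 < m) (hK : 0 < K) (hτ0 : 0 < τ) (hτ1 : τ ≤ 1)
    (hRiem : ∀ t ∈ Ico 0 T, (g t).IsRiemannian) {R V N Q : ℝ → M → ℝ}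
    (hdict : ∀ t ∈ Ico 0 T, ∀ x : M, m ≤ R t x ∧ 0 ≤ N t x - R t x ^ 2 / 4 ∧
      0 ≤ Q t x - 2 * N t x + R t x ^ 2 / 3 ∧
      (Q t x - 2 * N t x + R t x ^ 2 / 3) + 2 * (N t x - R t x ^ 2 / 4) ≤ K * R t x ^ (2 - τ))
    (hV0 : ∀ t ∈ Ico 0 T, ∀ x : M, 0 ≤ V t x)
    (hRs : ∀ T' : ℝ, 0 < T' → T' < T → ContMDiffOn ((𝓡 4).prod 𝓘(ℝ, ℝ)) 𝓘(ℝ, ℝ) ∞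
      (fun p : M × ℝ ↦ R p.2 p.1) (univ ×ˢ Icc 0 T'))
    (hVs : ∀ T' : ℝ, 0 < T' → T' < T → ContMDiffOn ((𝓡 4).prod 𝓘(ℝ, ℝ)) 𝓘(ℝ, ℝ) ∞
      (fun p : M × ℝ ↦ V p.2 p.1) (univ ×ˢ Icc 0 T'))
    (hNs : ∀ T' : ℝ, 0 < T' → T' < T → ContMDiffOn ((𝓡 4).prod 𝓘(ℝ, ℝ)) 𝓘(ℝ, ℝ) ∞
      (fun p : M × ℝ ↦ N p.2 p.1) (univ ×ˢ Icc 0 T'))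
    (hevol : ∀ (Λ η T' : ℝ), 0 ≤ Λ → 0 < T' → T' < T → ∀ t ∈ Icc 0 T', ∀ x : M,
      N t x - R t x ^ 2 / 4 ≤ Λ * R t x ^ 2 →
      derivWithin (fun s ↦ V s x / R s x + 180 * (1 + Λ) * (N s x - R s x ^ 2 / 4)
          - η * R s x ^ 2) (Icc 0 T') t ≤
        (g t).laplaceBeltrami (fun y ↦ V t y / R t y + 180 * (1 + Λ) * (N t y - R t y ^ 2 / 4)
          - η * R t y ^ 2) x +
          ((2 * η - 1) * V t x + 180 * (1 + Λ) * (64 * Real.sqrt (Q t x) + R t x) *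
            (N t x - R t x ^ 2 / 4) - 4 * η * (R t x * N t x)))
    {η : ℝ} (hη : 0 < η) :
    ∃ C : ℝ, ∀ t ∈ Ico 0 T, ∀ x : M, V t x ≤ η * R t x ^ 3 + C := by
  have hRpos : ∀ t ∈ Ico 0 T, ∀ x : M, 0 < R t x := fun t ht x ↦ hm.trans_le (hdict t ht x).1
  -- the constants `η₀ ≤ 1/2` and `Λ`
  obtain ⟨η₀, hη₀0, hη₀1, hη₀η⟩ : ∃ η₀ : ℝ, 0 < η₀ ∧ η₀ ≤ 1 / 2 ∧ 2 * η₀ ≤ η :=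
    ⟨min η 1 / 2, div_pos (lt_min hη one_pos) two_pos, by linarith [min_le_right η 1],
      by linarith [min_le_left η 1]⟩
  obtain ⟨Λ, hΛ0, hE⟩ : ∃ Λ : ℝ, 0 ≤ Λ ∧ ∀ t ∈ Ico 0 T, ∀ x : M,
      N t x - R t x ^ 2 / 4 ≤ Λ * R t x ^ 2 := by
    refine ⟨K * m ^ (-τ) / 2, div_nonneg (mul_nonneg hK.le (Real.rpow_nonneg hm.le _)) two_pos.le,
      fun t ht x ↦ ?_⟩
    obtain ⟨hmR, -, hW0, hp⟩ := hdict t ht x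
    exact gradientBound_traceless_le hm hK.le hτ0.le hmR hW0 hp
  obtain ⟨C₂, hC₂0, hC₂⟩ := gradientBound_source_le hm hK hτ0 hτ1 hΛ0 hη₀0 hη₀1
  -- `Φ ≤ C₂` along the flow
  have hΦ : ∀ t ∈ Ico 0 T, ∀ x : M, (2 * η₀ - 1) * V t x + 180 * (1 + Λ) *
      (64 * Real.sqrt (Q t x) + R t x) * (N t x - R t x ^ 2 / 4) - 4 * η₀ * (R t x * N t x) ≤ C₂ :=
    fun t ht x ↦ by
      obtain ⟨hmR, hE0, hW0, hp⟩ := hdict t ht x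
      exact hC₂ _ _ _ _ hmR (hV0 t ht x) hE0 hW0 hp
  -- restriction to `[0, T']`
  have hsub : ∀ {T' : ℝ}, T' < T → Icc 0 T' ⊆ Ico 0 T := fun hT' s hs ↦ ⟨hs.1, hs.2.trans_lt hT'⟩
  -- `α`: an upper bound for `u(0, ·)` over the compact `M`
  obtain ⟨α, hα⟩ : ∃ α : ℝ, ∀ x : M,
      V 0 x / R 0 x + 180 * (1 + Λ) * (N 0 x - R 0 x ^ 2 / 4) - η₀ * R 0 x ^ 2 ≤ α := by
    have hT2 : 0 < T / 2 := by positivity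
    have hT2T : T / 2 < T := by linarith
    have hu := gradientBound_smooth (Λ := Λ) (η₀ := η₀) (hRs _ hT2 hT2T) (hVs _ hT2 hT2T)
      (hNs _ hT2 hT2T) (fun s hs x ↦ hRpos s (hsub hT2T hs) x)
    have hcont := (contMDiff_slice (I := 𝓡 4)
      (u := fun s x ↦ V s x / R s x + 180 * (1 + Λ) * (N s x - R s x ^ 2 / 4) - η₀ * R s x ^ 2)
      hu (t := 0) ⟨le_rfl, hT2.le⟩).continuous
    obtain ⟨α, hα⟩ := (isCompact_range hcont).bddAbove
    exact ⟨α, fun x ↦ mem_upperBounds.1 hα _ (mem_range_self x)⟩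
  -- the weak maximum principle on every `[0, t]`: `u ≤ α + T C₂` on `[0, T)`
  have hub : ∀ t ∈ Ico 0 T, ∀ x : M,
      V t x / R t x + 180 * (1 + Λ) * (N t x - R t x ^ 2 / 4) - η₀ * R t x ^ 2 ≤ α + T * C₂ := by
    intro t ht x
    have hTC : 0 ≤ T * C₂ := mul_nonneg hT.le hC₂0
    rcases ht.1.eq_or_lt with h0 | ht0
    · subst h0
      linarith [hα x]
    · have key := gradientBound_maxPrinciple (R := R) (V := V) (N := N) (Q := Q) (Λ := Λ)
        (η₀ := η₀) (C₂ := C₂) (α := α) ht0 (fun s hs ↦ hRiem s (hsub ht.2 hs))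
        (hRs t ht0 ht.2) (hVs t ht0 ht.2) (hNs t ht0 ht.2) (fun s hs y ↦ hRpos s (hsub ht.2 hs) y)
        (fun s hs y ↦ hevol Λ η₀ t hΛ0 ht0 ht.2 s hs y (hE s (hsub ht.2 hs) y))
        (fun s hs y ↦ hΦ s (hsub ht.2 hs) y) hα t ⟨ht0.le, le_rfl⟩ x
      have htC : t * C₂ ≤ T * C₂ := mul_le_mul_of_nonneg_right ht.2.le hC₂0
      linarith
  -- conclusion
  obtain ⟨C, hC⟩ := gradientBound_final hη₀0 (α + T * C₂)
  refine ⟨C, fun t ht x ↦ ?_⟩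
  have h1 := hC (R t x) (V t x) (N t x - R t x ^ 2 / 4) (180 * (1 + Λ)) (hRpos t ht x)
    (hdict t ht x).2.1 (mul_nonneg (by norm_num) (by linarith)) (hub t ht x)
  have hR3 : 0 ≤ R t x ^ 3 := pow_nonneg (hRpos t ht x).le 3
  linarith [mul_le_mul_of_nonneg_right hη₀η hR3]

end FourDim

/-! ### The registered helper -/

/-- **HELPER H3 — HAMILTON'S GRADIENT ESTIMATE `|∇R|² ≤ ηR³ + C(η)` (Hamilton 1982, §11,
Thm. 11.1), the weak-maximum-principle endgame.** Along a Ricci flow on `[0, T)` on a closed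
4-manifold with the invariant pinching `m ≤ R`, `|W|² + 2|E|² ≤ K R^{2−τ}`, GIVEN the joint
smoothness of `|∇R|²` and `|Ric|²` on every `M × [0, T']` and the evolution inequality
`∂ₜu ≤ Δu + (2η−1)|∇R|² + 180(1+Λ)(64√|Rm|² + R)|E|² − 4ηR|Ric|²` for
`u = |∇R|²/R + 180(1+Λ)|E|² − ηR²` (every `Λ ≥ 0`, `η`, `0 < T' < T`, wherever `|E|² ≤ ΛR²`):
for every `η > 0` there is `C` with `|∇R|² ≤ ηR³ + C` on `M × [0, T)`. Proof: `gradientBound_core`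
with `R, V = |∇R|², N = |Ric|², Q = |Rm|²` read through the flow's Levi-Civita witness
(`roundness_dictionary`), `V ≥ 0` (`gradientBound_gradSq_nonneg`) and the joint regularity of `R`
(`IsRicciFlow.contMDiffOn_scalarCurvatureWith`). [cite: Hamilton1982, §11, Thm. 11.1] -/
theorem helper_gradientBound_of_evolution : ∀ (M : Type) [TopologicalSpace M] [T2Space M] [SecondCountableTopology M] [ChartedSpace (EuclideanSpace ℝ (Fin 4)) M] [IsManifold (𝓡 4) ∞ M] [CompactSpace M] (g : ℝ → PseudoRiemannianMetric (𝓡 4) ∞ (EuclideanSpace ℝ (Fin 4)) (TangentSpace (𝓡 4) : M → Type _)) (cov : ℝ → CovariantDerivative (𝓡 4) (EuclideanSpace ℝ (Fin 4)) (TangentSpace (𝓡 4) : M → Type _)) (T m K τ : ℝ), 0 < T → 0 < m → 0 < K → 0 < τ → τ ≤ 1 → IsRicciFlow g cov (Ico 0 T) → (∀ t ∈ Ico 0 T, (g t).IsRiemannian) → (∀ t ∈ Ico 0 T, ∀ [(g t).HasLeviCivita] (x : M), m ≤ (g t).scalarCurvature x ∧ (g t).weylNormSq x + 2 * (g t).tracelessRicciNormSq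 x ≤ K * (g t).scalarCurvature x ^ (2 - τ)) → (∀ T' : ℝ, 0 < T' → T' < T → ContMDiffOn ((𝓡 4).prod 𝓘(ℝ, ℝ)) 𝓘(ℝ, ℝ) ∞ (fun p : M × ℝ ↦ (g p.2).gradSq (fun y ↦ (g p.2).scalarCurvatureWith (cov p.2) y) p.1) (univ ×ˢ Icc 0 T')) → (∀ T' : ℝ, 0 < T' → T' < T → ContMDiffOn ((𝓡 4).prod 𝓘(ℝ, ℝ)) 𝓘(ℝ, ℝ) ∞ (fun p : M × ℝ ↦ (g p.2).normSq p.1 ((cov p.2).ricci p.1)) (univ ×ˢ Icc 0 T')) → (∀ (Λ η T' : ℝ), 0 ≤ Λ → 0 < T' → T' < T → ∀ t ∈ Icc 0 T', ∀ x : M, (g t).normSq x ((cov t).ricci x) - (g t).scalarCurvatureWith (cov t) x ^ 2 / 4 ≤ Λ * (g t).scalarCurvatureWith (cov t) x ^ 2 → derivWithin (fun s ↦ (g s).gradSq (fun y ↦ (g s).scalarCurvatureWith (cov s) y) x / (g s).scalarCurvatureWith (cov s) x + 180 * (1 + Λ) * ((g s).normSq x ((cov s).ricci x) - (g s).scalarCurvatureWith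 (cov s) x ^ 2 / 4) - η * (g s).scalarCurvatureWith (cov s) x ^ 2) (Icc 0 T') t ≤ (g t).laplaceBeltrami (fun y ↦ (g t).gradSq (fun z ↦ (g t).scalarCurvatureWith (cov t) z) y / (g t).scalarCurvatureWith (cov t) y + 180 * (1 + Λ) * ((g t).normSq y ((cov t).ricci y) - (g t).scalarCurvatureWith (cov t) y ^ 2 / 4) - η * (g t).scalarCurvatureWith (cov t) y ^ 2) x + ((2 * η - 1) * (g t).gradSq (fun y ↦ (g t).scalarCurvatureWith (cov t) y) x + 180 * (1 + Λ) * (64 * Real.sqrt ((g t).curvNormSqWith (cov t) x) + (g t).scalarCurvatureWith (cov t) x) * ((g t).normSq x ((cov t).ricci x) - (g t).scalarCurvatureWith (cov t) x ^ 2 / 4) - 4 * η * ((g t).scalarCurvatureWith (cov t) x * (g t).normSq x ((cov t).ricci x)))) → ∀ η : ℝ, 0 < η → ∃ C : ℝ, ∀ t ∈ Ico 0 T, ∀ x : M, (g t).gradSq (fun y ↦ (g t).scalarCurvatureWith (cov t) y) x ≤ η * (g t).scalarCurvatureWith (cov t) x ^ 3 + C := by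
  intro M _ _ _ _ _ _ g cov T m K τ hT hm hK hτ0 hτ1 hflow hRiem hpinch hVs hNs hevol η hη
  have hsub : ∀ {T' : ℝ}, T' < T → Icc 0 T' ⊆ Ico 0 T := fun hT' s hs ↦ ⟨hs.1, hs.2.trans_lt hT'⟩
  exact gradientBound_core (g := g) (R := fun s y ↦ (g s).scalarCurvatureWith (cov s) y)
    (V := fun s y ↦ (g s).gradSq (fun z ↦ (g s).scalarCurvatureWith (cov s) z) y)
    (N := fun s y ↦ (g s).normSq y ((cov s).ricci y)) (Q := fun s y ↦ (g s).curvNormSqWith (cov s) y)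
    hT hm hK hτ0 hτ1 hRiem (fun t ht x ↦ roundness_dictionary hflow hRiem hpinch ht x)
    (fun t ht x ↦ gradientBound_gradSq_nonneg (hRiem t ht) _ x)
    (fun T' _ hT'T ↦ (hflow.mono (hsub hT'T)).contMDiffOn_scalarCurvatureWith) hVs hNs hevol hη

end Summit.SmoothPoincare4.SmoothPoincare4.Theorems.MargerinRails

end
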